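import Summits.Ventures.PercRepro.C025ProfileGirthSuccSuccParts
import Summits.Ventures.PercRepro.C025ProfileGirthHallSuccA

/-!
# THE ROW `(q, q+2)` AT GIRTH `≥ q+1` — THE PAIR SETS OF A FAT SET DETERMINE IT (night-3 g20)

The fat rank-`q` sets (`≥ q + 1` points) are paid by their PAIR SETS `X ∪ {y, y'}`: two points outside `X` with
`ρ(X ∪ {y, y'}) = q + 2`.  This module proves, at girth `≥ q + 1`:
* `choose_succ_succ_mul_choose_two` — `C(p+q, q+2) · C(q+2, 2) = C(p+q, q) · C(p, 2)` (the level-`(q+2)` price is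
  `C(p,2)/C(q+2,2)`);
* `notMem_closure_of_mem_pair` — the two points of a pair set lie outside `cl X`;
* `card_inter_le_of_closure_ne` — two rank-`q` sets with different closures share at most `q − 1` points;
* **`eq_of_union_pair_eq`** — a pair set determines its fat set: `X ∪ Y = X' ∪ Y'` forces `X = X'` (with the same
  closure the pair lies outside it; with different closures `X, X'` would be two `(q+1)`-sets meeting in `q − 1`
  points inside a `(q+3)`-set of rank `q + 2`, against submodularity);
* `union_pair_mem_levelSet_not_clean` — a pair set is a level-`(q+2)` set containing a dependent `(q+1)`-set.
Companion modules: `C025ProfileGirthSuccSuccPairCount` (the pair count) and `C025ProfileGirthSuccSuccFat` (T3 and the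
row from (T2′)).  No `def`, no `instance`, no notation.  Axioms: standard.
-/

open scoped Matroid

namespace PercRepro

open Set Finset ThmH Staged

namespace GirthRows

variable {α : Type} [DecidableEq α] {M : Matroid α} [M.Finite]

/-- `C(p+q, q+2) · C(q+2, 2) = C(p+q, q) · C(p, 2)` (the level-`(q+2)` price is `C(p,2)/C(q+2,2)`). -/
theorem choose_succ_succ_mul_choose_two (p q : ℕ) :
    (p + q).choose (q + 2) * (q + 2).choose 2 = (p + q).choose q * p.choose 2 := by
  rcases Nat.lt_or_ge p 2 with hp | hp
  · have h1 : (p + q).choose (q + 2) = 0 := Nat.choose_eq_zero_of_lt (by omega)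
    have h2 : p.choose 2 = 0 := Nat.choose_eq_zero_of_lt hp
    rw [h1, h2, zero_mul, mul_zero]
  · have h1 : (p + q).choose (q + 2) = (p + q).choose (p - 2) :=
      Nat.choose_symm_of_eq_add (by omega)
    have h2 : (p + q).choose q = (p + q).choose p := Nat.choose_symm_of_eq_add (by omega)
    have h3 := Nat.choose_mul (n := p + q) (k := p) (s := p - 2) (by omega)
    have h4 : p + q - (p - 2) = q + 2 := by omega
    have h5 : p - (p - 2) = 2 := by omega
    rw [h4, h5] at h3
    have h6 : p.choose (p - 2) = p.choose 2 := Nat.choose_symm (by omega)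
    rw [h1, h2, ← h3, h6]

/-- A point of a pair set lies outside the closure of the fat set. -/
theorem notMem_closure_of_mem_pair {q : ℕ} {X Y : Finset α} (hXg : X ⊆ gr M) (hXr : rkN M X = q)
    (hY : Y ∈ ((gr M \ X).powersetCard 2).filter (fun Y => rkN M (X ∪ Y) = q + 2)) {y : α} (hy : y ∈ Y) :
    y ∉ M.closure (X : Set α) := by
  rw [Finset.mem_filter, Finset.mem_powersetCard] at hY
  obtain ⟨⟨hYg, hYc⟩, hYr⟩ := hY
  intro hyc
  have hyg : y ∈ gr M := (Finset.mem_sdiff.1 (hYg hy)).1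
  -- `X ∪ Y = insert y' (insert y X)` with `y' ∈ Y`; the rank rises by at most `1` from `insert y X`, whose rank is `q`
  have h1 : rkN M (insert y X) = rkN M X := ((mem_closure_iff_rkN_insert hXg hyg).1 hyc)
  have hsub : insert y X ⊆ X ∪ Y := by
    intro z hz
    rw [Finset.mem_insert] at hz
    rcases hz with rfl | hz
    · exact Finset.mem_union_right _ hy
    · exact Finset.mem_union_left _ hz
  have h2 := rkN_le_rkN_add_card_sdiff (M := M) hsub
  have h3 : ((X ∪ Y) \ insert y X).card ≤ 1 := by
    have : (X ∪ Y) \ insert y X ⊆ Y.erase y := by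
      intro z hz
      rw [Finset.mem_sdiff, Finset.mem_union, Finset.mem_insert] at hz
      rw [Finset.mem_erase]
      push Not at hz
      exact ⟨hz.2.1, hz.1.resolve_left hz.2.2⟩
    have := Finset.card_le_card this
    rw [Finset.card_erase_of_mem hy, hYc] at this
    exact this
  omega

/-- Two fat sets of rank `q` with different closures share at most `q − 1` points (at girth `≥ q + 1`): a common
`q`-subset would be independent and span both. -/
theorem card_inter_le_of_closure_ne {q : ℕ} (hg : ∀ T ⊆ M.E, T.encard ≤ q → M.Indep T) {X X' : Finset α}
    (hXg : X ⊆ gr M) (hX'g : X' ⊆ gr M) (hXr : rkN M X = q) (hX'r : rkN M X' = q)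
    (hne : M.closure (X : Set α) ≠ M.closure (X' : Set α)) : (X ∩ X').card ≤ q - 1 := by
  by_contra hcon
  push Not at hcon
  -- a `q`-subset `T` of `X ∩ X'` is independent, hence of rank `q`, and spans `cl X` and `cl X'`
  obtain ⟨T, hTsub, hTc⟩ := Finset.exists_subset_card_eq (show q ≤ (X ∩ X').card by omega)
  have hTX : T ⊆ X := hTsub.trans Finset.inter_subset_left
  have hTX' : T ⊆ X' := hTsub.trans Finset.inter_subset_right
  have hTr : rkN M T = q := rkN_eq_of_card_eq_of_girth hg (hTX.trans hXg) hTc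
  have h1 : M.closure (X : Set α) = M.closure (T : Set α) :=
    closure_eq_of_subset_of_rkN_eq hXg hTX (by rw [hXr, hTr])
  have h2 : M.closure (X' : Set α) = M.closure (T : Set α) :=
    closure_eq_of_subset_of_rkN_eq hX'g hTX' (by rw [hX'r, hTr])
  exact hne (h1.trans h2.symm)

/-- **A pair set determines its fat set.** If `X ∪ Y = X' ∪ Y'` for fat sets `X, X'` of rank `q` (`≥ q + 1` points
each) and pairs `Y, Y'` of theirs, then `X = X'`. -/
theorem eq_of_union_pair_eq {q : ℕ} (hq : 1 ≤ q) (hg : ∀ T ⊆ M.E, T.encard ≤ q → M.Indep T)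
    {X X' Y Y' : Finset α}
    (hXg : X ⊆ gr M) (hX'g : X' ⊆ gr M) (hXr : rkN M X = q) (hX'r : rkN M X' = q)
    (hX'c : q + 1 ≤ X'.card)
    (hY : Y ∈ ((gr M \ X).powersetCard 2).filter (fun Y => rkN M (X ∪ Y) = q + 2))
    (hY' : Y' ∈ ((gr M \ X').powersetCard 2).filter (fun Y => rkN M (X' ∪ Y) = q + 2))
    (heq : X ∪ Y = X' ∪ Y') : X = X' := by
  have hYmem := hY
  have hY'mem := hY'
  rw [Finset.mem_filter, Finset.mem_powersetCard] at hYmem hY'mem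
  obtain ⟨⟨hYg, hYc⟩, hYr⟩ := hYmem
  obtain ⟨⟨hY'g, hY'c⟩, hY'r⟩ := hY'mem
  by_cases hcl : M.closure (X : Set α) = M.closure (X' : Set α)
  · -- same closure: `X' ⊆ X ∪ Y` and the points of `Y` lie outside `cl X = cl X'`, so `X' ⊆ X`; symmetrically
    have hX'X : X' ⊆ X := by
      intro z hz
      have hzS : z ∈ X ∪ Y := heq ▸ Finset.mem_union_left _ hz
      rw [Finset.mem_union] at hzS
      rcases hzS with h | h
      · exact h
      · exfalso
        apply notMem_closure_of_mem_pair hXg hXr hY h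
        rw [hcl]
        exact M.mem_closure_of_mem hz (by rw [← coe_gr]; exact_mod_cast hX'g)
    have hXX' : X ⊆ X' := by
      intro z hz
      have hzS : z ∈ X' ∪ Y' := heq ▸ Finset.mem_union_left _ hz
      rw [Finset.mem_union] at hzS
      rcases hzS with h | h
      · exact h
      · exfalso
        apply notMem_closure_of_mem_pair hX'g hX'r hY' h
        rw [← hcl]
        exact M.mem_closure_of_mem hz (by rw [← coe_gr]; exact_mod_cast hXg)
    exact Finset.Subset.antisymm hXX' hX'X
  · -- different closures: `|X ∩ X'| ≤ q − 1`, so `X' ⊆ X ∪ Y` forces `Y ⊆ X'`, `|X'| = q + 1`; then `X ∪ Y = X ∪ X'` has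
    -- rank `≤ q + 1` by submodularity
    exfalso
    have hinter := card_inter_le_of_closure_ne hg hXg hX'g hXr hX'r hcl
    have hX'sub : X' ⊆ X ∪ Y := heq ▸ Finset.subset_union_left
    have hXsub : X ⊆ X' ∪ Y' := heq.symm ▸ Finset.subset_union_left
    -- `X' ⊆ (X ∩ X') ∪ Y`
    have h1 : X' ⊆ (X ∩ X') ∪ Y := by
      intro z hz
      have := hX'sub hz
      rw [Finset.mem_union] at this ⊢
      rcases this with h | h
      · exact Or.inl (Finset.mem_inter.2 ⟨h, hz⟩)
      · exact Or.inr h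
    have h1c := Finset.card_le_card h1
    have h1c' := Finset.card_union_le (X ∩ X') Y
    -- so `|X'| ≤ q + 1`, hence `= q + 1`, and `Y ⊆ X'` with `|X ∩ X'| = q − 1`
    have hX'eq : X'.card = q + 1 := by omega
    -- `Y ⊆ X'`: every point of `Y` lies in `X' ∪ Y'`; if it were in `Y'` ... we only need `X ∪ Y ⊆ X ∪ X'`
    -- From `|X' ∖ X| ≥ 2` and `X' ∖ X ⊆ Y` with `|Y| = 2` we get `Y = X' ∖ X ⊆ X'`.
    have hYsub : Y ⊆ X' := by
      have hdiff : X' \ X ⊆ Y := by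
        intro z hz
        rw [Finset.mem_sdiff] at hz
        have := hX'sub hz.1
        rw [Finset.mem_union] at this
        exact this.resolve_left hz.2
      have hdc : (X' \ X).card = X'.card - (X ∩ X').card := by
        rw [Finset.card_sdiff, Finset.inter_comm]
      have h2 : 2 ≤ (X' \ X).card := by omega
      have hYeq : X' \ X = Y := Finset.eq_of_subset_of_card_le hdiff (by omega)
      rw [← hYeq]
      exact Finset.sdiff_subset
    -- submodularity on `X, X'`
    have hsub := ThinTriangle.rkN_inter_add_union_le (M := M) X X'
    have hunion : X ∪ Y ⊆ X ∪ X' := Finset.union_subset_union (Finset.Subset.refl _) hYsub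
    have hr1 : rkN M (X ∪ Y) ≤ rkN M (X ∪ X') := rkN_mono hunion
    -- `ρ(X ∩ X') = |X ∩ X'|` (girth) — we only need `ρ(X ∩ X') ≥ q − 1`, which needs `|X ∩ X'| = q − 1`
    have hic : (X ∩ X').card = q - 1 := by omega
    have hg' : ∀ T ⊆ M.E, T.encard ≤ ((q - 1 : ℕ) : ℕ∞) → M.Indep T :=
      fun T hT h => hg T hT (h.trans (by exact_mod_cast Nat.sub_le q 1))
    have hir : rkN M (X ∩ X') = q - 1 :=
      rkN_eq_of_card_eq_of_girth hg' ((Finset.inter_subset_left).trans hXg) hic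
    omega

/-- A pair set of a fat set is a level-`(q+2)` set that is not clean. -/
theorem union_pair_mem_levelSet_not_clean {q : ℕ} {X Y : Finset α} (hXg : X ⊆ gr M) (hXr : rkN M X = q)
    (hXc : q + 1 ≤ X.card)
    (hY : Y ∈ ((gr M \ X).powersetCard 2).filter (fun Y => rkN M (X ∪ Y) = q + 2)) :
    X ∪ Y ∈ Shadow.levelSet M (q + 2) ∧
      ¬ ∀ T ⊆ X ∪ Y, T.card = q + 1 → M.Indep (T : Set α) := by
  rw [Finset.mem_filter, Finset.mem_powersetCard] at hY
  obtain ⟨⟨hYg, _⟩, hYr⟩ := hY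
  refine ⟨?_, ?_⟩
  · rw [Profile.mem_levelSet]
    refine ⟨Finset.union_subset hXg (hYg.trans Finset.sdiff_subset), ?_⟩
    rw [← Staged.coe_rkN, hYr]
  · intro hclean
    obtain ⟨T, hTX, hTc⟩ := Finset.exists_subset_card_eq hXc
    have hTi := hclean T (hTX.trans Finset.subset_union_left) hTc
    have h1 : rkN M T ≤ rkN M X := rkN_mono hTX
    have h2 : rkN M T = T.card := by
      rw [Staged.rkN_eq_iff, hTi.eRk_eq_encard, Set.encard_coe_eq_coe_finsetCard]
    omega


end GirthRows

end PercRepro
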